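import Mathlib

/-!
# Unified isosceles law (ENGINE B, pub-hlocus abs-2 g49) — helper anchor

certified instances and evidence bearing on the general Hodge conjecture; no claim.

Abstract core of UNI-1 (DERIVATIONS_engineB §66.17): if `lev : X → X → ℕ` is an agreement level
(ultrametric: `min (lev x y) (lev y z) ≤ lev x z`) invariant under a finite group `G` acting on `X`, then the
ORBIT level `L x y = max_g lev x (g • y)` is again ultrametric; hence every triple of orbit levels is isosceles
(the two lowest are equal), which is the common source of the caps (CAP-3), the couples (COUPLE-1) and the latent
couples (MIXED-2) of the ζ₃ pair census.
-/

set_option linter.dupNamespace false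

namespace Summit.HodgeConjecture.HodgeConjecture.HodgeLocus.Census.UnifiedIsoscelesB

variable {X G : Type*} [Group G] [Fintype G] [MulAction G X]

/-- Orbit level: the best agreement of `x` with a `G`-translate of `y`. -/
def orbitLevel (lev : X → X → ℕ) (x y : X) : ℕ :=
  (Finset.univ : Finset G).sup (fun g : G => lev x (g • y))

/-- Every translate's level is bounded by the orbit level. -/
theorem le_orbitLevel (lev : X → X → ℕ) (x y : X) (g : G) :
    lev x (g • y) ≤ orbitLevel (G := G) lev x y :=
  Finset.le_sup (f := fun g : G => lev x (g • y)) (Finset.mem_univ g)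

/-- The orbit level is attained by some group element. -/
theorem orbitLevel_attained [Nonempty G] (lev : X → X → ℕ) (x y : X) :
    ∃ g : G, orbitLevel (G := G) lev x y = lev x (g • y) := by
  obtain ⟨g, -, hg⟩ := Finset.exists_mem_eq_sup (Finset.univ : Finset G) Finset.univ_nonempty
    (fun g : G => lev x (g • y))
  exact ⟨g, hg⟩

/-- The orbit level of a `G`-invariant ultrametric level is ultrametric. -/
theorem orbitLevel_ultra [Nonempty G] (lev : X → X → ℕ)
    (hultra : ∀ x y z, min (lev x y) (lev y z) ≤ lev x z)
    (hinv : ∀ (g : G) (x y : X), lev (g • x) (g • y) = lev x y) (x y z : X) :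
    min (orbitLevel (G := G) lev x y) (orbitLevel (G := G) lev y z) ≤ orbitLevel (G := G) lev x z := by
  obtain ⟨g, hg⟩ := orbitLevel_attained (G := G) lev x y
  obtain ⟨h, hh⟩ := orbitLevel_attained (G := G) lev y z
  have h1 : lev (g • y) ((g * h) • z) = lev y (h • z) := by rw [mul_smul, hinv]
  calc min (orbitLevel (G := G) lev x y) (orbitLevel (G := G) lev y z)
        = min (lev x (g • y)) (lev (g • y) ((g * h) • z)) := by rw [hg, hh, h1]
    _ ≤ lev x ((g * h) • z) := hultra _ _ _
    _ ≤ orbitLevel (G := G) lev x z := le_orbitLevel (G := G) lev x z (g * h)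

/-- Isosceles principle for three mutually ultrametric levels: the two lowest are equal. -/
theorem isosceles (a b c : ℕ) (h1 : min a c ≤ b) (h2 : min a b ≤ c) (h3 : min b c ≤ a) :
    (a = b ∧ a ≤ c) ∨ (a = c ∧ a ≤ b) ∨ (b = c ∧ b ≤ a) := by omega

/-- Cap / couple corollary: if the horizon `c` (level between `y` and its twist) is strictly below the level `a`
of the pair, the twisted pair sits exactly at the horizon: `b = c`. -/
theorem couple_of_lt (a b c : ℕ) (h1 : min a c ≤ b) (h2 : min a b ≤ c) (h3 : min b c ≤ a) (hlt : c < a) :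
    b = c := by omega

/-- Cap corollary: if the two horizons differ (`c ≠ c'`) and both triples are ultrametric, the pair level is
bounded by the smaller horizon. -/
theorem cap_of_ne (a b c c' : ℕ) (h1 : min a c ≤ b) (h2 : min a b ≤ c) (h3 : min b c ≤ a)
    (h1' : min a c' ≤ b) (h2' : min a b ≤ c') (h3' : min b c' ≤ a) (hne : c ≠ c') :
    a ≤ min c c' := by omega

end Summit.HodgeConjecture.HodgeConjecture.HodgeLocus.Census.UnifiedIsoscelesB
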